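import Literature.MathematicalPhysics.QuantumFieldTheory.ConformalBootstrap3D.PointCertificateTableUnbounded

/-!
# The unbounded two-row table theorem with the identity obligation direct / in chord form

`boxExcluded_of_pointTable₂_unbounded` (the two-bit head-cell table, `Q ⊆ [s_lo, s_hi] ×
([ε_lo, ε_hi) ∪ [t₀₀, ∞))`) asks rule (O1) — positivity of the functional on the unit operator,
`0 < φ[F^{s}_-[1]]` for `s ∈ [s_lo, s_hi]` — through the σ-CORNER number
`termCornerBound w z z̄ 0 0 0 s_lo s_hi`.  For an LP point functional the unit-operator value is small
against its gross mass `Σ_k |w_k| (v_k^s + u_k^s)`, and the corner loss, FIRST order in the width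
`s_hi − s_lo`, defeats it at the certificates' native width `10⁻³` (pub-ising3d, all four production
tables of TABLECHECK R5/R8: corner numbers `−1.8·10⁻² … −3.6·10⁻²`), while the CHORD number
`termChordMin w z z̄ 0 s_lo s_hi 0 0` of `PointFunctionalChord` (second order; `j = 0`, `E₁ = E₂ = 0`,
`𝒫_{0,0} ≡ 1`) does not (`+2.8·10⁻³ … +3.2·10⁻⁴`, one piece).  This file

* derives (O1) on `Q` from ONE chord number (`identity_pos_of_chordMin`) and from a ROW of chord
  numbers on consecutive pieces `[σ_i, σ_{i+1}]` covering `[s_lo, s_hi]` (`identity_pos_of_chordRow`;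
  the production certificates of smaller identity value need `K_I = 3 … 41` pieces);
* restates the schema and the unbounded two-row table theorem with the (O1) obligation supplied
  DIRECTLY on `Q` (`boxExcluded_of_pointRules_twistI`, `boxExcluded_of_pointRules_twist_unboundedI`,
  `boxExcluded_of_pointTable₂_unboundedI` — the tree theorems verbatim otherwise), and
* the corollary with (O1) as a chord row (`boxExcluded_of_pointTable₂_unboundedC`), of which the
  pub-ising3d tables (chord identity, `K_I = 1`) are literal instances.

Term basis: Hogervorst–Rychkov 2013, §3 eq. (3.6). [cite: HogervorstRychkov2013, §3 eq. (3.6)]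
-/

noncomputable section

namespace Literature.MathematicalPhysics.QuantumFieldTheory.ConformalBootstrap3D

open Finset Set

/-! ### (O1) from chord numbers -/

/-- **(O1) on a box from one chord number.** Nodes in the open square, node ratios `≥ 1/2` for the
`s`-width; `0 < termChordMin w z z̄ 0 s_lo s_hi 0 0` gives `φ[F^{s}_{-}[1]] > 0` for every
`s ∈ [s_lo, s_hi]`. [cite: HogervorstRychkov2013, §3 eq. (3.6)] -/
theorem identity_pos_of_chordMin {N : ℕ} (w z zb : Fin N → ℝ)
    (hz : ∀ k, z k ∈ Ioo (0 : ℝ) 1) (hzb : ∀ k, zb k ∈ Ioo (0 : ℝ) 1) {slo shi : ℝ}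
    (hr : ∀ k, 1 / 2 ≤ ((1 - z k) * (1 - zb k)) ^ (shi - slo) ∧ 1 / 2 ≤ (z k * zb k) ^ (shi - slo))
    (h : 0 < termChordMin w z zb 0 slo shi 0 0) {s : ℝ} (hs : s ∈ Icc slo shi) :
    0 < pointFunctional w z zb (crossF s (-1) (fun _ _ => (1 : ℝ))) := by
  have hρ : ∀ k, 1 / 2 ≤ (z k * zb k) ^ (((0 : ℝ) - 0) / 2) ∧
      1 / 2 ≤ ((1 - z k) * (1 - zb k)) ^ (((0 : ℝ) - 0) / 2) := by
    intro k
    simp only [sub_self, zero_div, Real.rpow_zero]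
    norm_num
  have hle := termChordMin_le w z zb hz hzb 0 hr hρ hs (E := 0) ⟨le_rfl, le_rfl⟩
  rw [zMono_zero_zero] at hle
  exact h.trans_le hle

/-- Consecutive closed pieces `[σ_i, σ_{i+1}]`, `i < K`, `0 < K`, cover `[σ_0, σ_K]` (no monotonicity
of `σ` needed). [folklore] -/
theorem exists_piece_Icc (σ : ℕ → ℝ) :
    ∀ K : ℕ, 0 < K → ∀ s ∈ Icc (σ 0) (σ K), ∃ i < K, s ∈ Icc (σ i) (σ (i + 1)) := by
  intro K
  induction K with
  | zero => intro h; exact absurd h (lt_irrefl 0)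
  | succ K ih =>
    intro _ s hs
    by_cases hK : K = 0
    · subst hK
      exact ⟨0, Nat.zero_lt_one, hs⟩
    · by_cases hlt : s ≤ σ K
      · obtain ⟨i, hi, hmem⟩ := ih (Nat.pos_of_ne_zero hK) s ⟨hs.1, hlt⟩
        exact ⟨i, by omega, hmem⟩
      · exact ⟨K, by omega, ⟨(not_le.1 hlt).le, hs.2⟩⟩

/-- A monotone row `σ_0 ≤ σ_1 ≤ ⋯ ≤ σ_K` stays in `[σ_0, σ_K]`. [folklore] -/
theorem piece_sub_of_monotone (σ : ℕ → ℝ) (K : ℕ) (hmono : ∀ i < K, σ i ≤ σ (i + 1)) :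
    ∀ i, i ≤ K → σ 0 ≤ σ i ∧ σ i ≤ σ K := by
  have up : ∀ i, i ≤ K → σ 0 ≤ σ i := by
    intro i
    induction i with
    | zero => intro; exact le_rfl
    | succ i ih => intro hi; exact (ih (by omega)).trans (hmono i (by omega))
  have down : ∀ d i, i + d = K → σ i ≤ σ K := by
    intro d
    induction d with
    | zero => intro i hi; simp only [add_zero] at hi; rw [hi]
    | succ d ih =>
      intro i hi
      exact (hmono i (by omega)).trans (ih (i + 1) (by omega))
  exact fun i hi => ⟨up i hi, down (K - i) i (by omega)⟩

/-- For a base in `(0, 1]` the power is antitone in the exponent: a ratio condition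
`1/2 ≤ x^{d}` for the full width `d` passes to every sub-width `d' ≤ d`. [folklore] -/
theorem half_le_rpow_of_le {x d d' : ℝ} (hx0 : 0 < x) (hx1 : x ≤ 1) (hle : d' ≤ d)
    (h : 1 / 2 ≤ x ^ d) : 1 / 2 ≤ x ^ d' := by
  rcases eq_or_lt_of_le hx1 with hx | hx
  · rw [hx, Real.one_rpow]; norm_num
  · exact h.trans (Real.rpow_le_rpow_of_exponent_ge hx0 hx.le hle)

/-- **(O1) on a box from a chord ROW.** Nodes in the open square, node ratios `≥ 1/2` for the full
`s`-width, a monotone partition `s_lo = σ_0 ≤ σ_1 ≤ ⋯ ≤ σ_{K_I} = s_hi` (`K_I ≥ 1`) with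
`0 < termChordMin w z z̄ 0 σ_i σ_{i+1} 0 0` on every piece: then `φ[F^{s}_{-}[1]] > 0` for every
`s ∈ [s_lo, s_hi]`. [cite: HogervorstRychkov2013, §3 eq. (3.6)] -/
theorem identity_pos_of_chordRow {N : ℕ} (w z zb : Fin N → ℝ)
    (hz : ∀ k, z k ∈ Ioo (0 : ℝ) 1) (hzb : ∀ k, zb k ∈ Ioo (0 : ℝ) 1) {slo shi : ℝ}
    (hr : ∀ k, 1 / 2 ≤ ((1 - z k) * (1 - zb k)) ^ (shi - slo) ∧ 1 / 2 ≤ (z k * zb k) ^ (shi - slo))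
    (σ : ℕ → ℝ) (KI : ℕ) (hKI : 0 < KI) (hσ0 : σ 0 = slo) (hσK : σ KI = shi)
    (hmono : ∀ i < KI, σ i ≤ σ (i + 1))
    (hrow : ∀ i < KI, 0 < termChordMin w z zb 0 (σ i) (σ (i + 1)) 0 0)
    {s : ℝ} (hs : s ∈ Icc slo shi) :
    0 < pointFunctional w z zb (crossF s (-1) (fun _ _ => (1 : ℝ))) := by
  obtain ⟨i, hi, hmem⟩ := exists_piece_Icc σ KI hKI s ⟨hσ0 ▸ hs.1, hσK ▸ hs.2⟩
  have hb := piece_sub_of_monotone σ KI hmono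
  have hwid : σ (i + 1) - σ i ≤ shi - slo := by
    have h1 := (hb (i + 1) (by omega)).2
    have h2 := (hb i hi.le).1
    rw [hσK] at h1; rw [hσ0] at h2
    linarith
  have hri : ∀ k, 1 / 2 ≤ ((1 - z k) * (1 - zb k)) ^ (σ (i + 1) - σ i) ∧
      1 / 2 ≤ (z k * zb k) ^ (σ (i + 1) - σ i) := by
    intro k
    have hzk := hz k; have hzbk := hzb k
    have hv0 : 0 < (1 - z k) * (1 - zb k) := mul_pos (by linarith [hzk.2]) (by linarith [hzbk.2])
    have hv1 : (1 - z k) * (1 - zb k) ≤ 1 := by nlinarith [hzk.1, hzbk.1, hzk.2, hzbk.2]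
    have hu0 : 0 < z k * zb k := mul_pos hzk.1 hzbk.1
    have hu1 : z k * zb k ≤ 1 := by nlinarith [hzk.1, hzbk.1, hzk.2, hzbk.2]
    exact ⟨half_le_rpow_of_le hv0 hv1 hwid (hr k).1, half_le_rpow_of_le hu0 hu1 hwid (hr k).2⟩
  exact identity_pos_of_chordMin w z zb hz hzb hri (hrow i hi) hmem

/-! ### The schema and the unbounded table theorem with (O1) direct -/

/-- **Point-functional schema, twist domain, (O1) supplied on `Q` itself.** As
`boxExcluded_of_pointRules_twist` with `hI` replaced by the obligation `0 < φ[F^{s}_-[1]]` on `Q`.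
[cite: HogervorstRychkov2013, §3 eq. (3.6)] -/
theorem boxExcluded_of_pointRules_twistI {N : ℕ} {w z zb : Fin N → ℝ}
    (hz : ∀ k, z k ∈ Ioo (0 : ℝ) 1) (hzb : ∀ k, zb k ∈ Ioo (0 : ℝ) 1) (hord : ∀ k, zb k ≤ z k)
    (a : Fin N) (ha : 0 ≤ w a) (qd qr : Fin N → ℝ) (hqd : ∀ k, 0 < qd k ∧ qd k ≤ 1)
    (hqr : ∀ k, 0 < qr k ∧ qr k ≤ 1)
    (hdomd : ∀ k, z k * zb k ≤ qd k ^ 2 * (z a * zb a) ∧ z k ≤ qd k * z a)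
    (hdomr : ∀ k, (1 - z k) * (1 - zb k) ≤ qr k ^ 2 * (z a * zb a) ∧ 1 - zb k ≤ qr k * z a)
    {Q : Set (ℝ × ℝ)} {slo shi E₀ ET τ : ℝ} (hQ : ∀ p ∈ Q, slo ≤ p.1 ∧ p.1 ≤ shi)
    (hτ1 : τ ≤ 1) (hτ0 : τ ≤ E₀)
    (hI : ∀ p ∈ Q, 0 < pointFunctional w z zb (crossF p.1 (-1) (fun _ _ => (1 : ℝ))))
    (hO2 : ∀ p ∈ Q, BlockPositive (pointFunctional w z zb) p.1 p.2 0)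
    (hO3 : ∀ p ∈ Q, ∀ Δ : ℝ, 3 ≤ Δ → Δ < E₀ → BlockPositive (pointFunctional w z zb) p.1 Δ 0)
    (hO4 : ∀ p ∈ Q, ∀ ℓ : ℕ, Even ℓ → ℓ ≠ 0 → ∀ Δ : ℝ, (ℓ : ℝ) + 1 ≤ Δ → Δ < E₀ →
      BlockPositive (pointFunctional w z zb) p.1 Δ ℓ)
    (hM : ∀ (j : ℕ) (E : ℝ), E₀ ≤ E → E < ET → (j : ℝ) + τ ≤ E → ∀ p ∈ Q,
      0 ≤ pointFunctional w z zb (crossF p.1 (-1) (zMono E j)))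
    (hB : ∑ k ∈ univ.erase a, |w k| * ((1 - z k) * (1 - zb k)) ^ slo * qd k ^ ET
          + ∑ k, |w k| * (z k * zb k) ^ slo * qr k ^ ET ≤ w a * ((1 - z a) * (1 - zb a)) ^ shi) :
    BoxExcluded Q :=
  SingleCorrelatorObligations.boxExcluded (Δstar := E₀) hz hzb
    { identity_pos := hI
      epsilon_nonneg := hO2
      scalar_nonneg := hO3
      spinning_nonneg := hO4
      tail_nonneg := fun p hp ℓ _ Δ hbd hΔ0 =>
        tail_nonneg_pointFunctional_of_termwise_and_apex_twist w z zb hz hzb hord a ha qd qr hqd hqr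
          hdomd hdomr hQ hτ1 hτ0 hM hB p hp ℓ Δ hbd hΔ0 }

/-- **Point-functional schema, twist domain, (O1) on `Q` itself, (O2) only below `E₀`.** As
`boxExcluded_of_pointRules_twist_unbounded` with `hI` replaced by the obligation on `Q`; for
`Δ_ε ≥ E₀ (≥ 1/2)` rule (O2) follows from (M)+(T) through the tail theorem at `ℓ = 0`.
[cite: HogervorstRychkov2013, §3 eq. (3.6)] -/
theorem boxExcluded_of_pointRules_twist_unboundedI {N : ℕ} {w z zb : Fin N → ℝ}
    (hz : ∀ k, z k ∈ Ioo (0 : ℝ) 1) (hzb : ∀ k, zb k ∈ Ioo (0 : ℝ) 1) (hord : ∀ k, zb k ≤ z k)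
    (a : Fin N) (ha : 0 ≤ w a) (qd qr : Fin N → ℝ) (hqd : ∀ k, 0 < qd k ∧ qd k ≤ 1)
    (hqr : ∀ k, 0 < qr k ∧ qr k ≤ 1)
    (hdomd : ∀ k, z k * zb k ≤ qd k ^ 2 * (z a * zb a) ∧ z k ≤ qd k * z a)
    (hdomr : ∀ k, (1 - z k) * (1 - zb k) ≤ qr k ^ 2 * (z a * zb a) ∧ 1 - zb k ≤ qr k * z a)
    {Q : Set (ℝ × ℝ)} {slo shi E₀ ET τ : ℝ} (hQ : ∀ p ∈ Q, slo ≤ p.1 ∧ p.1 ≤ shi)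
    (hτ1 : τ ≤ 1) (hτ0 : τ ≤ E₀) (hE0 : 1 / 2 ≤ E₀)
    (hI : ∀ p ∈ Q, 0 < pointFunctional w z zb (crossF p.1 (-1) (fun _ _ => (1 : ℝ))))
    (hO2 : ∀ p ∈ Q, p.2 < E₀ → BlockPositive (pointFunctional w z zb) p.1 p.2 0)
    (hO3 : ∀ p ∈ Q, ∀ Δ : ℝ, 3 ≤ Δ → Δ < E₀ → BlockPositive (pointFunctional w z zb) p.1 Δ 0)
    (hO4 : ∀ p ∈ Q, ∀ ℓ : ℕ, Even ℓ → ℓ ≠ 0 → ∀ Δ : ℝ, (ℓ : ℝ) + 1 ≤ Δ → Δ < E₀ →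
      BlockPositive (pointFunctional w z zb) p.1 Δ ℓ)
    (hM : ∀ (j : ℕ) (E : ℝ), E₀ ≤ E → E < ET → (j : ℝ) + τ ≤ E → ∀ p ∈ Q,
      0 ≤ pointFunctional w z zb (crossF p.1 (-1) (zMono E j)))
    (hB : ∑ k ∈ univ.erase a, |w k| * ((1 - z k) * (1 - zb k)) ^ slo * qd k ^ ET
          + ∑ k, |w k| * (z k * zb k) ^ slo * qr k ^ ET ≤ w a * ((1 - z a) * (1 - zb a)) ^ shi) :
    BoxExcluded Q := by
  refine boxExcluded_of_pointRules_twistI hz hzb hord a ha qd qr hqd hqr hdomd hdomr hQ hτ1 hτ0 hI ?_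
    hO3 hO4 hM hB
  intro p hp
  by_cases h : p.2 < E₀
  · exact hO2 p hp h
  · have hb0 : unitarityBound3D 0 ≤ p.2 := by
      have : unitarityBound3D 0 = 1 / 2 := by simp [unitarityBound3D]
      rw [this]; linarith [not_lt.1 h]
    exact tail_nonneg_pointFunctional_of_termwise_and_apex_twist w z zb hz hzb hord a ha qd qr hqd
      hqr hdomd hdomr hQ hτ1 hτ0 hM hB p hp 0 p.2 hb0 (not_lt.1 h)

/-- **The two-row table with the scalar row's `Δ_ε`-range extended to `[t₀₀, ∞)`, identity
obligation direct.** Exactly the data and checks of `boxExcluded_of_pointTable₂_unbounded` with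
`hI` replaced by (O1) on `Q` itself, for `Q ⊆ [s_lo, s_hi] × ([ε_lo, ε_hi) ∪ [t₀₀, ∞))`.
[cite: HogervorstRychkov2013, §3 eq. (3.6)] -/
theorem boxExcluded_of_pointTable₂_unboundedI {N : ℕ} {w z zb : Fin N → ℝ}
    (hz : ∀ k, z k ∈ Ioo (0 : ℝ) 1) (hzb : ∀ k, zb k ∈ Ioo (0 : ℝ) 1) (hord : ∀ k, zb k ≤ z k)
    (apex : Fin N) (hapex : 0 ≤ w apex) (qd qr : Fin N → ℝ) (hqd : ∀ k, 0 < qd k ∧ qd k ≤ 1)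
    (hqr : ∀ k, 0 < qr k ∧ qr k ≤ 1)
    (hdomd : ∀ k, z k * zb k ≤ qd k ^ 2 * (z apex * zb apex) ∧ z k ≤ qd k * z apex)
    (hdomr : ∀ k, (1 - z k) * (1 - zb k) ≤ qr k ^ 2 * (z apex * zb apex) ∧
      1 - zb k ≤ qr k * z apex)
    {Q : Set (ℝ × ℝ)} {slo shi εlo εhi E₀ ET τ : ℝ}
    (t : ℕ → ℕ → ℝ) (K : ℕ → ℕ) (nF : ℕ → ℕ → ℕ) (hc hi : ℕ → ℕ → Bool)
    (tε : ℕ → ℝ) (Kε : ℕ) (nFε : ℕ → ℕ) (hcε hiε : ℕ → Bool)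
    (hQ : ∀ p ∈ Q, (slo ≤ p.1 ∧ p.1 ≤ shi) ∧ ((εlo ≤ p.2 ∧ p.2 < εhi) ∨ t 0 0 ≤ p.2))
    (L : ℕ) (hL : E₀ ≤ (L : ℝ) + 1) (hτ1 : τ ≤ 1) (hτ0 : τ ≤ E₀) (hE0 : 1 / 2 ≤ E₀)
    (hr : ∀ k, 1 / 2 ≤ ((1 - z k) * (1 - zb k)) ^ (shi - slo) ∧ 1 / 2 ≤ (z k * zb k) ^ (shi - slo))
    -- (O1), on `Q` itself
    (hI : ∀ p ∈ Q, 0 < pointFunctional w z zb (crossF p.1 (-1) (fun _ _ => (1 : ℝ))))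
    -- the ε-row (ℓ = 0)
    (htε : tε 0 = εlo ∧ tε Kε = εhi)
    (hlowε1 : ∀ k, k < Kε → hiε k = false → 1 ≤ tε k)
    (hlowεI : ∀ k, k < Kε → hiε k = true → 1 / 2 < tε k ∧ τ ≤ tε k)
    (hnFε : ∀ k, k < Kε → E₀ ≤ tε k + ((nFε k : ℝ) + 1))
    (hρε : ∀ k, k < Kε → hcε k = true → ∀ i, 1 / 2 ≤ (z i * zb i) ^ ((tε (k + 1) - tε k) / 2) ∧
      1 / 2 ≤ ((1 - z i) * (1 - zb i)) ^ ((tε (k + 1) - tε k) / 2))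
    (hheadε : ∀ k < Kε, 0 ≤ headNumber₂ w z zb 0 (tε k) (tε (k + 1)) slo shi (nFε k) (hcε k) (hiε k))
    -- the scalar row (ℓ = 0, from ≤ 3 to E₀) and the spinning rows (even 0 < ℓ < L, ℓ+1 to E₀)
    (ht0 : t 0 0 ≤ 3 ∧ t 0 (K 0) = E₀)
    (htℓ : ∀ ℓ, Even ℓ → ℓ ≠ 0 → ℓ < L → t ℓ 0 = (ℓ : ℝ) + 1 ∧ t ℓ (K ℓ) = E₀)
    (hlow1 : ∀ ℓ k, k < K ℓ → hi ℓ k = false → (ℓ : ℝ) + 1 ≤ t ℓ k)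
    (hlowI : ∀ ℓ k, k < K ℓ → hi ℓ k = true → unitarityBound3D ℓ < t ℓ k ∧ (ℓ : ℝ) + τ ≤ t ℓ k)
    (hnF : ∀ ℓ k, k < K ℓ → E₀ ≤ t ℓ k + ((nF ℓ k : ℝ) + 1))
    (hρ : ∀ ℓ k, k < K ℓ → hc ℓ k = true → ∀ i, 1 / 2 ≤ (z i * zb i) ^ ((t ℓ (k + 1) - t ℓ k) / 2) ∧
      1 / 2 ≤ ((1 - z i) * (1 - zb i)) ^ ((t ℓ (k + 1) - t ℓ k) / 2))
    (hhead : ∀ ℓ, (ℓ = 0 ∨ (Even ℓ ∧ ℓ < L)) → ∀ k < K ℓ,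
      0 ≤ headNumber₂ w z zb ℓ (t ℓ k) (t ℓ (k + 1)) slo shi (nF ℓ k) (hc ℓ k) (hi ℓ k))
    -- (M) box rows, twist-gap domain
    (e : ℕ → ℕ → ℝ) (M : ℕ → ℕ) (bc : ℕ → ℕ → Bool)
    (he : ∀ j : ℕ, (j : ℝ) + τ < ET → e j 0 ≤ max E₀ ((j : ℝ) + τ) ∧ ET ≤ e j (M j))
    (hρM : ∀ j m, m < M j → bc j m = true → ∀ k, 1 / 2 ≤ (z k * zb k) ^ ((e j (m + 1) - e j m) / 2) ∧
      1 / 2 ≤ ((1 - z k) * (1 - zb k)) ^ ((e j (m + 1) - e j m) / 2))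
    (hbox : ∀ j : ℕ, (j : ℝ) + τ < ET → ∀ m < M j,
      0 ≤ boxNumber w z zb j (e j m) (e j (m + 1)) slo shi (bc j m))
    -- (T)
    (hB : ∑ k ∈ univ.erase apex, |w k| * ((1 - z k) * (1 - zb k)) ^ slo * qd k ^ ET
          + ∑ k, |w k| * (z k * zb k) ^ slo * qr k ^ ET ≤
          w apex * ((1 - z apex) * (1 - zb apex)) ^ shi) :
    BoxExcluded Q := by
  have hQ1 : ∀ p ∈ Q, slo ≤ p.1 ∧ p.1 ≤ shi := fun p hp => (hQ p hp).1
  have hM := ruleM_of_boxTable_twist w z zb hz hzb τ hQ1 hr e M bc he hρM hbox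
  have hcell : ∀ ℓ, (ℓ = 0 ∨ (Even ℓ ∧ ℓ < L)) → ∀ k < K ℓ, ∀ p ∈ Q,
      ∀ Δ ∈ Ico (t ℓ k) (t ℓ (k + 1)), BlockPositive (pointFunctional w z zb) p.1 Δ ℓ :=
    fun ℓ hℓ k hk => cell_of_headNumber₂ w z zb hz hzb hord apex hapex qd qr hqd hqr hdomd hdomr
      hQ1 hτ1 hM hB hr (nF ℓ k) (hnF ℓ k hk) (hc ℓ k) (hi ℓ k) (hlow1 ℓ k hk) (hlowI ℓ k hk)
      (hρ ℓ k hk) (hhead ℓ hℓ k hk)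
  have hb0 : unitarityBound3D 0 = 1 / 2 := by simp [unitarityBound3D]
  have hcellε : ∀ k < Kε, ∀ p ∈ Q,
      ∀ Δ ∈ Ico (tε k) (tε (k + 1)), BlockPositive (pointFunctional w z zb) p.1 Δ 0 :=
    fun k hk => cell_of_headNumber₂ w z zb hz hzb hord apex hapex qd qr hqd hqr hdomd hdomr
      hQ1 hτ1 hM hB hr (nFε k) (hnFε k hk) (hcε k) (hiε k)
      (fun h => by simpa using hlowε1 k hk h)
      (fun h => by
        obtain ⟨h1, h2⟩ := hlowεI k hk h
        exact ⟨by rw [hb0]; exact h1, by simpa using h2⟩)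
      (hρε k hk) (hheadε k hk)
  refine boxExcluded_of_pointRules_twist_unboundedI hz hzb hord apex hapex qd qr hqd hqr hdomd hdomr
    hQ1 hτ1 hτ0 hE0 hI ?_ ?_ ?_ hM hB
  · -- (O2) below E₀: ε-row or scalar row
    intro p hp hlt
    rcases (hQ p hp).2 with hε | h0
    · exact blockPositive_of_cells_Ico tε Kε hcellε p hp p.2 ⟨htε.1 ▸ hε.1, htε.2 ▸ hε.2⟩
    · exact blockPositive_of_cells_Ico (t 0) (K 0) (hcell 0 (Or.inl rfl)) p hp p.2
        ⟨h0, ht0.2 ▸ hlt⟩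
  · exact scalar_nonneg_of_cells (t 0) (K 0) ht0.1 ht0.2 (hcell 0 (Or.inl rfl))
  · exact spinning_nonneg_of_cells L hL t K (fun ℓ hev hℓ hℓL => (htℓ ℓ hev hℓ hℓL).1.le)
      (fun ℓ hev hℓ hℓL => (htℓ ℓ hev hℓ hℓL).2)
      (fun ℓ hev hℓ hℓL => hcell ℓ (Or.inr ⟨hev, hℓL⟩))

/-- **The unbounded two-row table with the identity as a chord ROW** — the form certified by the
pub-ising3d table evaluators (TABLECHECK R5/R8: `K_I = 1`, i.e. `σ_0 = s_lo`, `σ_1 = s_hi`; the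
production certificates need `K_I ≤ 41` pieces).  Exactly `boxExcluded_of_pointTable₂_unboundedI`
with (O1) discharged by `identity_pos_of_chordRow`: a monotone partition
`s_lo = σ_0 ≤ ⋯ ≤ σ_{K_I} = s_hi`, `K_I ≥ 1`, and `0 < termChordMin w z z̄ 0 σ_i σ_{i+1} 0 0` on every
piece. [cite: HogervorstRychkov2013, §3 eq. (3.6)] -/
theorem boxExcluded_of_pointTable₂_unboundedC {N : ℕ} {w z zb : Fin N → ℝ}
    (hz : ∀ k, z k ∈ Ioo (0 : ℝ) 1) (hzb : ∀ k, zb k ∈ Ioo (0 : ℝ) 1) (hord : ∀ k, zb k ≤ z k)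
    (apex : Fin N) (hapex : 0 ≤ w apex) (qd qr : Fin N → ℝ) (hqd : ∀ k, 0 < qd k ∧ qd k ≤ 1)
    (hqr : ∀ k, 0 < qr k ∧ qr k ≤ 1)
    (hdomd : ∀ k, z k * zb k ≤ qd k ^ 2 * (z apex * zb apex) ∧ z k ≤ qd k * z apex)
    (hdomr : ∀ k, (1 - z k) * (1 - zb k) ≤ qr k ^ 2 * (z apex * zb apex) ∧
      1 - zb k ≤ qr k * z apex)
    {Q : Set (ℝ × ℝ)} {slo shi εlo εhi E₀ ET τ : ℝ}
    (t : ℕ → ℕ → ℝ) (K : ℕ → ℕ) (nF : ℕ → ℕ → ℕ) (hc hi : ℕ → ℕ → Bool)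
    (tε : ℕ → ℝ) (Kε : ℕ) (nFε : ℕ → ℕ) (hcε hiε : ℕ → Bool)
    (hQ : ∀ p ∈ Q, (slo ≤ p.1 ∧ p.1 ≤ shi) ∧ ((εlo ≤ p.2 ∧ p.2 < εhi) ∨ t 0 0 ≤ p.2))
    (L : ℕ) (hL : E₀ ≤ (L : ℝ) + 1) (hτ1 : τ ≤ 1) (hτ0 : τ ≤ E₀) (hE0 : 1 / 2 ≤ E₀)
    (hr : ∀ k, 1 / 2 ≤ ((1 - z k) * (1 - zb k)) ^ (shi - slo) ∧ 1 / 2 ≤ (z k * zb k) ^ (shi - slo))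
    -- (O1) as a chord row
    (σ : ℕ → ℝ) (KI : ℕ) (hKI : 0 < KI) (hσ0 : σ 0 = slo) (hσK : σ KI = shi)
    (hσmono : ∀ i < KI, σ i ≤ σ (i + 1))
    (hIrow : ∀ i < KI, 0 < termChordMin w z zb 0 (σ i) (σ (i + 1)) 0 0)
    -- the ε-row (ℓ = 0)
    (htε : tε 0 = εlo ∧ tε Kε = εhi)
    (hlowε1 : ∀ k, k < Kε → hiε k = false → 1 ≤ tε k)
    (hlowεI : ∀ k, k < Kε → hiε k = true → 1 / 2 < tε k ∧ τ ≤ tε k)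
    (hnFε : ∀ k, k < Kε → E₀ ≤ tε k + ((nFε k : ℝ) + 1))
    (hρε : ∀ k, k < Kε → hcε k = true → ∀ i, 1 / 2 ≤ (z i * zb i) ^ ((tε (k + 1) - tε k) / 2) ∧
      1 / 2 ≤ ((1 - z i) * (1 - zb i)) ^ ((tε (k + 1) - tε k) / 2))
    (hheadε : ∀ k < Kε, 0 ≤ headNumber₂ w z zb 0 (tε k) (tε (k + 1)) slo shi (nFε k) (hcε k) (hiε k))
    -- the scalar row and the spinning rows
    (ht0 : t 0 0 ≤ 3 ∧ t 0 (K 0) = E₀)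
    (htℓ : ∀ ℓ, Even ℓ → ℓ ≠ 0 → ℓ < L → t ℓ 0 = (ℓ : ℝ) + 1 ∧ t ℓ (K ℓ) = E₀)
    (hlow1 : ∀ ℓ k, k < K ℓ → hi ℓ k = false → (ℓ : ℝ) + 1 ≤ t ℓ k)
    (hlowI : ∀ ℓ k, k < K ℓ → hi ℓ k = true → unitarityBound3D ℓ < t ℓ k ∧ (ℓ : ℝ) + τ ≤ t ℓ k)
    (hnF : ∀ ℓ k, k < K ℓ → E₀ ≤ t ℓ k + ((nF ℓ k : ℝ) + 1))
    (hρ : ∀ ℓ k, k < K ℓ → hc ℓ k = true → ∀ i, 1 / 2 ≤ (z i * zb i) ^ ((t ℓ (k + 1) - t ℓ k) / 2) ∧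
      1 / 2 ≤ ((1 - z i) * (1 - zb i)) ^ ((t ℓ (k + 1) - t ℓ k) / 2))
    (hhead : ∀ ℓ, (ℓ = 0 ∨ (Even ℓ ∧ ℓ < L)) → ∀ k < K ℓ,
      0 ≤ headNumber₂ w z zb ℓ (t ℓ k) (t ℓ (k + 1)) slo shi (nF ℓ k) (hc ℓ k) (hi ℓ k))
    -- (M) box rows, twist-gap domain
    (e : ℕ → ℕ → ℝ) (M : ℕ → ℕ) (bc : ℕ → ℕ → Bool)
    (he : ∀ j : ℕ, (j : ℝ) + τ < ET → e j 0 ≤ max E₀ ((j : ℝ) + τ) ∧ ET ≤ e j (M j))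
    (hρM : ∀ j m, m < M j → bc j m = true → ∀ k, 1 / 2 ≤ (z k * zb k) ^ ((e j (m + 1) - e j m) / 2) ∧
      1 / 2 ≤ ((1 - z k) * (1 - zb k)) ^ ((e j (m + 1) - e j m) / 2))
    (hbox : ∀ j : ℕ, (j : ℝ) + τ < ET → ∀ m < M j,
      0 ≤ boxNumber w z zb j (e j m) (e j (m + 1)) slo shi (bc j m))
    -- (T)
    (hB : ∑ k ∈ univ.erase apex, |w k| * ((1 - z k) * (1 - zb k)) ^ slo * qd k ^ ET
          + ∑ k, |w k| * (z k * zb k) ^ slo * qr k ^ ET ≤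
          w apex * ((1 - z apex) * (1 - zb apex)) ^ shi) :
    BoxExcluded Q :=
  boxExcluded_of_pointTable₂_unboundedI hz hzb hord apex hapex qd qr hqd hqr hdomd hdomr t K nF hc hi
    tε Kε nFε hcε hiε hQ L hL hτ1 hτ0 hE0 hr
    (fun p hp => identity_pos_of_chordRow w z zb hz hzb hr σ KI hKI hσ0 hσK hσmono hIrow
      ⟨(hQ p hp).1.1, (hQ p hp).1.2⟩)
    htε hlowε1 hlowεI hnFε hρε hheadε ht0 htℓ hlow1 hlowI hnF hρ hhead e M bc he hρM hbox hB

end Literature.MathematicalPhysics.QuantumFieldTheory.ConformalBootstrap3D
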